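import Literature.NumberTheory.GaloisRepresentations.IdeleCohomologyLimit
import HarnessLib

/-!
# Equivariant homomorphisms into the idèle group from their local blocks:
# `Hom_G(X, J_E) ⊇ Hom_G(X, J_{E,S}) = ∏_{v∈S} Hom_G(X, ∏_{w∣v} E_wˣ) × ∏_{v∉S} Hom_G(X, ∏_{w∣v} 𝒪_wˣ) × ∏_{v∣∞} Hom_G(X, ∏_{w∣v} E_wˣ)`
# (Tate, C–F VII §7.3; Milne *ADT* I Lemma 4.13)

Topic `NumberTheory/GaloisRepresentations`; namespace `Literature.NumberTheory.GaloisRepresentations.IdeleReadout`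
(generic part in `….IdeleReadout.RepPi`).  Definitions with bodies and theorems; NO named fact, no `sorry`, no instance,
no notation; number fields in `Type`.  Sequel to `IdeleSUnitsCohomology.lean` (`blockProj S i : J_{E,S} ⟶ blockFamily E S i`
jointly BIJECTIVE, `blockProj_bijective`) and `IdeleCohomologyLimit.lean` (`placeProj v`, `infPlaceProj v`,
`ideleSRepHom_comp_placeProj`, `blockUnitGroup_comp_unitGroupRepHom`, `ideleSRepHom_comp_infPlaceProj`).

Why (Route A of crux `AnticycControlAdditiveK`, item 19295; door-c6 g16's presentation road, hypothesis (R3) of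
`middleExact_allPlaces_of_readout`: "`Hom_G(N₁, J_E) = ∏'_v Hom_{D_w}(N₁, E_wˣ)`", FINDING-door-c6-g16 §3 F6).  Milne's
idèle-valued homomorphism `f : N₁ → J_E` is assembled from its semi-local blocks: morphisms `X ⟶ ∏_{w∣v} E_wˣ` at the
finitely many finite places `v ∈ S`, morphisms `X ⟶ ∏_{w∣v} 𝒪_wˣ` at the finite places `v ∉ S`, and morphisms
`X ⟶ ∏_{w∣v} E_wˣ` at the infinite places.  Since `J_{E,S}` IS the direct product of these blocks as a `Gal(E/F)`-module
(`blockProj_bijective`), a family of `G`-morphisms into the blocks is the same as a `G`-morphism into `J_{E,S} ⊆ J_E`;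
this file writes the (generic) lifting through a jointly bijective family of morphisms of representations and reads
off the place projections of the assembled morphism.  The semi-local blocks themselves come from LOCAL equivariant
homomorphisms `X → K̄_vˣ` (`IdeleReadoutLocalHom.lean`: `assembleLocalHom`, `assembleLocalHomUnit`).

## What is formalised

* §1 (generic, `k` a commutative ring, `G` a group, `π i : P ⟶ A i` jointly bijective in `Rep k G`): `RepPi.piEquiv`,
  **`RepPi.lift π hπ φ : X ⟶ P`** with **`lift_comp : lift ≫ π i = φ i`**, `hom_ext` (morphisms into `P` are determined
  by their components), `eq_lift`.
* §2 (`F E : Type` number fields, `S` a finite set of finite places of `F`, `X : Rep ℤ Gal(E/F)`):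
  **`ideleSHomOfBlocks S φ : X ⟶ ideleSRep F E S`**, `blocks S φS φU φA` (the three kinds of data as one family),
  **`ideleHomOfBlocks S φS φU φA : X ⟶ ideleRep F E`** with **`ideleHomOfBlocks_comp_placeProj_of_mem`**
  (`= φS v`), **`ideleHomOfBlocks_comp_placeProj_of_not_mem`** (`= φU v ≫ (∏ 𝒪_wˣ ↪ ∏ E_wˣ)`),
  **`ideleHomOfBlocks_comp_infPlaceProj`** (`= φA v`); `ideleRep_hom_ext` (a `G`-morphism into `J_E` is determined
  by its place projections), `ideleHomOfBlocks_mem_ideleS` (values in `J_{E,S}`).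

## References
* J. W. S. Cassels, A. Fröhlich (eds.), *Algebraic Number Theory* (1967), Ch. VII (Tate) §7.3 (`J_{L,S}` as a product).
  [CasselsFrohlichANT1967]
* J. S. Milne, *Arithmetic Duality Theorems* (2nd ed. 2006), I Lemma 4.13 (proof). [MilneADT2006]
* K. S. Brown, *Cohomology of Groups*, GTM 87 (1982), VIII §4 (products). [Brown1982CohomologyGroups]
-/

noncomputable section

open NumberField IsDedekindDomain CategoryTheory
open Literature.NumberTheory.Automorphic

namespace Literature.NumberTheory.GaloisRepresentations

namespace IdeleReadout

/-! ## §1. Generic: morphisms into a representation presented as a product -/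

namespace RepPi

universe u

variable {k : Type u} [CommRing k] {G : Type u} [Group G] {ι : Type u} {P : Rep.{u} k G} {A : ι → Rep.{u} k G}
variable (π : ∀ i, P ⟶ A i) (hπ : Function.Bijective fun (p : P.V) (i : ι) => (π i).hom p)

/-- **`P ≃ ∏_i A_i` linearly**, from a jointly bijective family of morphisms `π i : P ⟶ A i`.
[cite: Brown1982CohomologyGroups, VIII §4] -/
def piEquiv : P.V ≃ₗ[k] (∀ i, (A i).V) :=
  LinearEquiv.ofBijective (LinearMap.pi fun i => (π i).hom.toLinearMap) hπ

/-- `piEquiv p i = π i p`. [cite: Brown1982CohomologyGroups, VIII §4] -/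
@[simp] theorem piEquiv_apply (p : P.V) (i : ι) : piEquiv π hπ p i = (π i).hom p := rfl

/-- `π i (piEquiv⁻¹ y) = y i`. [cite: Brown1982CohomologyGroups, VIII §4] -/
@[simp] theorem hom_piEquiv_symm (y : ∀ i, (A i).V) (i : ι) : (π i).hom ((piEquiv π hπ).symm y) = y i :=
  congrFun ((piEquiv π hπ).apply_symm_apply y) i

/-- `piEquiv⁻¹` is equivariant: `piEquiv⁻¹ (g • y) = g • piEquiv⁻¹ y` (the `π i` are). [cite: Brown1982CohomologyGroups, VIII §4] -/
theorem piEquiv_symm_ρ (g : G) (y : ∀ i, (A i).V) :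
    (piEquiv π hπ).symm (fun i => (A i).ρ g (y i)) = P.ρ g ((piEquiv π hπ).symm y) := by
  apply (piEquiv π hπ).injective
  funext i
  rw [piEquiv_apply, hom_piEquiv_symm, piEquiv_apply, Rep.hom_comm_apply, hom_piEquiv_symm]

variable {X : Rep.{u} k G}

/-- **The morphism `X ⟶ P` with prescribed components `φ i : X ⟶ A i`** (`P` presented as the product of the `A i` by
the jointly bijective `π`). [cite: Brown1982CohomologyGroups, VIII §4] -/
def lift (φ : ∀ i, X ⟶ A i) : X ⟶ P :=
  Rep.ofHom (ρ := X.ρ) (σ := P.ρ)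
    ⟨(piEquiv π hπ).symm.toLinearMap ∘ₗ LinearMap.pi fun i => (φ i).hom.toLinearMap,
      fun g => LinearMap.ext fun x => by
        change (piEquiv π hπ).symm (fun i => (φ i).hom (X.ρ g x)) = P.ρ g ((piEquiv π hπ).symm fun i => (φ i).hom x)
        rw [← piEquiv_symm_ρ]
        congr 1
        funext i
        exact Rep.hom_comm_apply (φ i) g x⟩

/-- Unfolding `lift`. [cite: Brown1982CohomologyGroups, VIII §4] -/
theorem lift_apply (φ : ∀ i, X ⟶ A i) (x : X.V) :
    (lift π hπ φ).hom x = (piEquiv π hπ).symm fun i => (φ i).hom x := rfl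

/-- **`lift φ ≫ π i = φ i`.** [cite: Brown1982CohomologyGroups, VIII §4] -/
theorem lift_comp (φ : ∀ i, X ⟶ A i) (i : ι) : lift π hπ φ ≫ π i = φ i :=
  Rep.hom_ext (Representation.IntertwiningMap.ext (LinearMap.ext fun x => by
    change (π i).hom ((lift π hπ φ).hom x) = (φ i).hom x
    rw [lift_apply, hom_piEquiv_symm]))

/-- Elementwise: `π i (lift φ x) = φ i x`. [cite: Brown1982CohomologyGroups, VIII §4] -/
theorem hom_lift_apply (φ : ∀ i, X ⟶ A i) (i : ι) (x : X.V) : (π i).hom ((lift π hπ φ).hom x) = (φ i).hom x := by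
  rw [lift_apply, hom_piEquiv_symm]

include hπ in
/-- **Morphisms into `P` are determined by their components.** [cite: Brown1982CohomologyGroups, VIII §4] -/
theorem hom_ext {f g : X ⟶ P} (h : ∀ i, f ≫ π i = g ≫ π i) : f = g :=
  Rep.hom_ext (Representation.IntertwiningMap.ext (LinearMap.ext fun x => hπ.1 (funext fun i => by
    change (π i).hom (f.hom x) = (π i).hom (g.hom x)
    rw [← Rep.comp_apply, ← Rep.comp_apply, h i])))

/-- A morphism with components `φ` IS `lift φ`. [cite: Brown1982CohomologyGroups, VIII §4] -/
theorem eq_lift (φ : ∀ i, X ⟶ A i) {f : X ⟶ P} (h : ∀ i, f ≫ π i = φ i) : f = lift π hπ φ :=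
  hom_ext π hπ fun i => by rw [h, lift_comp]

end RepPi

/-! ## §2. Equivariant homomorphisms into `J_{E,S}` and `J_E` from blocks -/

open IdeleCohomology

variable {F : Type} [Field F] [NumberField F] {E : Type} [Field E] [NumberField E] [Algebra F E]
variable (S : Finset (HeightOneSpectrum (𝓞 F))) {X : Rep.{0} ℤ (E ≃ₐ[F] E)}

/-- **The `G`-morphism `X ⟶ J_{E,S}` with prescribed blocks** (`J_{E,S}` is the product of its blocks,
`blockProj_bijective`). [cite: CasselsFrohlichANT1967, Ch. VII §7.3] -/
def ideleSHomOfBlocks (φ : ∀ i : BlockIndex S, X ⟶ blockFamily E S i) : X ⟶ ideleSRep F E S :=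
  RepPi.lift (blockProj S) (blockProj_bijective S) φ

/-- `ideleSHomOfBlocks φ ≫ blockProj i = φ i`. [cite: CasselsFrohlichANT1967, Ch. VII §7.3] -/
theorem ideleSHomOfBlocks_comp_blockProj (φ : ∀ i : BlockIndex S, X ⟶ blockFamily E S i) (i : BlockIndex S) :
    ideleSHomOfBlocks S φ ≫ blockProj S i = φ i :=
  RepPi.lift_comp _ _ φ i

/-- Morphisms into `J_{E,S}` are determined by their blocks. [cite: CasselsFrohlichANT1967, Ch. VII §7.3] -/
theorem ideleSRep_hom_ext {f g : X ⟶ ideleSRep F E S} (h : ∀ i : BlockIndex S, f ≫ blockProj S i = g ≫ blockProj S i) :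
    f = g :=
  RepPi.hom_ext (blockProj S) (blockProj_bijective S) h

/-- **The three kinds of local data as one family of blocks**: morphisms into `∏_{w∣v} E_wˣ` at `v ∈ S`, into
`∏_{w∣v} 𝒪_wˣ` at `v ∉ S`, into `∏_{w∣v} E_wˣ` at `v ∣ ∞`. [cite: CasselsFrohlichANT1967, Ch. VII §7.3] -/
def blocks (φS : ∀ v : {v : HeightOneSpectrum (𝓞 F) // v ∈ S}, X ⟶ SemiLocal.unitsRep F E v.1)
    (φU : ∀ v : {v : HeightOneSpectrum (𝓞 F) // v ∉ S}, X ⟶ SemiLocal.unitGroupRep F E v.1)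
    (φA : ∀ v : InfinitePlace F, X ⟶ ArchHerbrand.archUnitsRep (E := E) v) :
    ∀ i : BlockIndex S, X ⟶ blockFamily E S i
  | Sum.inl v => φS v
  | Sum.inr (Sum.inl v) => φU v
  | Sum.inr (Sum.inr v) => φA v

variable (φS : ∀ v : {v : HeightOneSpectrum (𝓞 F) // v ∈ S}, X ⟶ SemiLocal.unitsRep F E v.1)
  (φU : ∀ v : {v : HeightOneSpectrum (𝓞 F) // v ∉ S}, X ⟶ SemiLocal.unitGroupRep F E v.1)
  (φA : ∀ v : InfinitePlace F, X ⟶ ArchHerbrand.archUnitsRep (E := E) v)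

/-- **The `G`-morphism `X ⟶ J_E` assembled from local blocks** (through `J_{E,S} ⊆ J_E`).
[cite: CasselsFrohlichANT1967, Ch. VII §7.3] [cite: MilneADT2006, I Lemma 4.13 (proof)] -/
def ideleHomOfBlocks : X ⟶ IdeleClassGroup.ideleRep F E :=
  ideleSHomOfBlocks S (blocks S φS φU φA) ≫ ideleSRepHom S

/-- The assembled morphism through `J_{E,S}`. [cite: CasselsFrohlichANT1967, Ch. VII §7.3] -/
theorem ideleHomOfBlocks_eq : ideleHomOfBlocks S φS φU φA = ideleSHomOfBlocks S (blocks S φS φU φA) ≫ ideleSRepHom S :=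
  rfl

/-- **The values of the assembled morphism lie in `J_{E,S}`** (components of valuation one off `S`).
[cite: CasselsFrohlichANT1967, Ch. VII §7.3] -/
theorem ideleHomOfBlocks_mem_ideleS (x : X.V) :
    Additive.toMul (α := ideleGroup E) ((ideleHomOfBlocks S φS φU φA).hom x) ∈ ideleS F E S := by
  rw [ideleHomOfBlocks_eq, Rep.comp_apply, ideleSRepHom_apply, toMul_ofMul]
  exact Subtype.coe_prop _

/-- **At `v ∈ S` the semi-local block of the assembled morphism is `φS v`.** [cite: CasselsFrohlichANT1967, Ch. VII §7.3] -/
theorem ideleHomOfBlocks_comp_placeProj_of_mem {v : HeightOneSpectrum (𝓞 F)} (hv : v ∈ S) :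
    ideleHomOfBlocks S φS φU φA ≫ placeProj v = φS ⟨v, hv⟩ := by
  rw [ideleHomOfBlocks_eq, Category.assoc, ideleSRepHom_comp_placeProj]
  exact ideleSHomOfBlocks_comp_blockProj S _ (Sum.inl ⟨v, hv⟩)

/-- **At `v ∉ S` the semi-local block of the assembled morphism is `φU v` followed by `∏ 𝒪_wˣ ↪ ∏ E_wˣ`.**
[cite: CasselsFrohlichANT1967, Ch. VII §7.3] -/
theorem ideleHomOfBlocks_comp_placeProj_of_not_mem {v : HeightOneSpectrum (𝓞 F)} (hv : v ∉ S) :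
    ideleHomOfBlocks S φS φU φA ≫ placeProj v = φU ⟨v, hv⟩ ≫ SemiLocal.unitGroupRepHom F E v := by
  rw [ideleHomOfBlocks_eq, Category.assoc, ideleSRepHom_comp_placeProj, ← blockUnitGroup_comp_unitGroupRepHom S hv,
    ← Category.assoc]
  exact congrArg (· ≫ SemiLocal.unitGroupRepHom F E v) (ideleSHomOfBlocks_comp_blockProj S _ (Sum.inr (Sum.inl ⟨v, hv⟩)))

/-- **At an infinite place the archimedean block of the assembled morphism is `φA v`.**
[cite: CasselsFrohlichANT1967, Ch. VII §7.3] -/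
theorem ideleHomOfBlocks_comp_infPlaceProj (v : InfinitePlace F) :
    ideleHomOfBlocks S φS φU φA ≫ infPlaceProj v = φA v := by
  rw [ideleHomOfBlocks_eq, Category.assoc, ideleSRepHom_comp_infPlaceProj]
  exact ideleSHomOfBlocks_comp_blockProj S _ (Sum.inr (Sum.inr v))

/-- Elementwise: the semi-local block at `v ∈ S`. [cite: CasselsFrohlichANT1967, Ch. VII §7.3] -/
theorem placeProj_ideleHomOfBlocks_apply_of_mem {v : HeightOneSpectrum (𝓞 F)} (hv : v ∈ S) (x : X.V) :
    (placeProj v).hom ((ideleHomOfBlocks S φS φU φA).hom x) = (φS ⟨v, hv⟩).hom x := by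
  rw [← Rep.comp_apply, ideleHomOfBlocks_comp_placeProj_of_mem]

/-- Elementwise: the semi-local block at `v ∉ S`. [cite: CasselsFrohlichANT1967, Ch. VII §7.3] -/
theorem placeProj_ideleHomOfBlocks_apply_of_not_mem {v : HeightOneSpectrum (𝓞 F)} (hv : v ∉ S) (x : X.V) :
    (placeProj v).hom ((ideleHomOfBlocks S φS φU φA).hom x) =
      (SemiLocal.unitGroupRepHom F E v).hom ((φU ⟨v, hv⟩).hom x) := by
  rw [← Rep.comp_apply, ideleHomOfBlocks_comp_placeProj_of_not_mem, Rep.comp_apply]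

/-- Elementwise: the archimedean block. [cite: CasselsFrohlichANT1967, Ch. VII §7.3] -/
theorem infPlaceProj_ideleHomOfBlocks_apply (v : InfinitePlace F) (x : X.V) :
    (infPlaceProj v).hom ((ideleHomOfBlocks S φS φU φA).hom x) = (φA v).hom x := by
  rw [← Rep.comp_apply, ideleHomOfBlocks_comp_infPlaceProj]

/-- **A `G`-morphism into `J_E` is determined by its place projections** (finite semi-local blocks and archimedean
cut-offs; `eq_of_blocks_eq`). [cite: CasselsFrohlichANT1967, Ch. VII §7.3] -/
theorem ideleRep_hom_ext {f g : X ⟶ IdeleClassGroup.ideleRep F E}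
    (hfin : ∀ v : HeightOneSpectrum (𝓞 F), f ≫ placeProj v = g ≫ placeProj v)
    (hinf : ∀ v : InfinitePlace F, f ≫ infPlaceProj v = g ≫ infPlaceProj v) : f = g := by
  letI : Module ℤ X.V := X.hV2
  refine Rep.hom_ext (Representation.IntertwiningMap.ext (LinearMap.ext fun x => ?_))
  change f.hom x = g.hom x
  apply (Additive.toMul (α := ideleGroup E)).injective
  refine eq_of_blocks_eq (F := F) (fun v => ?_) (fun v => ?_)
  · have h := congrArg (fun ψ : X ⟶ SemiLocal.unitsRep F E v => Additive.toMul (α := (SemiLocal F E v)ˣ) (ψ.hom x))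
      (hfin v)
    exact h
  · have h := congrArg (fun ψ : X ⟶ ArchHerbrand.archUnitsRep (E := E) v =>
      Additive.toMul (α := ArchHerbrand.infUnits E v) (ψ.hom x)) (hinf v)
    exact h

end IdeleReadout

end Literature.NumberTheory.GaloisRepresentations

end
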